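import Literature.ComputerArithmetic.Shewchuk1997.Compress
import Mathlib.Tactic.Linarith
import Mathlib.Tactic.Positivity
import Mathlib.Tactic.Ring
import Mathlib.Tactic.NormNum
import Mathlib.Tactic.FieldSimp

/-!
# The thirteen roundings of the travelling window of COMPRESS, at every precision `p ≥ 3` (new work)

New work of the certified-arithmetic venture (ENGINES group: shared numerical engines serving
client cells; rigour lives in the verifiers; every published number belongs to a client cell's
ledger, not to the engines group).  NOT a published theorem:
Shewchuk [Shewchuk1997, §2.7] proves Theorem 23 only and says nothing about iterating COMPRESS.
This is the `p`-SYMBOLIC form of the roundings of `CompressWindow.lean` (its instance `p = 3`):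
precision `p = q + 3` for an arbitrary `q : ℕ`, IEEE ties-to-even `roundTiesEven (q + 3) em`, `em ≤ 0`,
the rounding model of [BoldoEtAl2023, §2.1–2.2].  Docstring notation: `h = 2^(p−1) = 4·2^q`, so
`h + 1 = 4·2^q + 1`, `h − 1 = 4·2^q − 1`, `2h − 1 = 8·2^q − 1`, `3h/2 + 1 = 6·2^q + 1`; and `2^p = 8·2^q`,
`2^(2p−1) = 32·(2^q)^2`, `2^(3p) = 512·(2^q)^3`, `2^(4p−1) = 2048·(2^q)^4`, `2^(4p) = 4096·(2^q)^4`,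
`2^(5p) = 32768·(2^q)^5` — every statement is written in the right-hand forms, polynomial in `2^q`.
Each `rneG_*` certifies ONE rounding `RN(x + y) = s` by exhibiting the binade `2^m ≤ |x + y| < 2^(m+1)`,
the unit in the last place `2^(m−p+1)` and the position of `x + y` relative to the midpoint
(`rne_up_certG` / `rne_down_certG` / `rne_tie_certG`).  Nine of them drive the window pass and the kink's last
step (`CompressWindowGeneric.lean`), four make the window's neighbours inert; ONE is a tie:
`2^(3p) + (−(h−1))·2^(2p−1) = (3h+1)·2^(2p−1) ↦ 3h·2^(2p−1)` (even significand), at every `p ≥ 3`.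
-/

namespace Summit.Ventures.CertifiedArithmetic.Expansions

open Literature.ComputerArithmetic.JeannerodRump2018
open Literature.ComputerArithmetic.BoldoJeannerodMelquiondMuller2023 hiding twoSum twoSum_fst
open Literature.ComputerArithmetic.Shewchuk1997

variable {q : ℕ} {em : ℤ}

/-! ### Rounding certificates (as in `CompressWindow.lean`, with natural exponents) -/

/-- `2^m ≤ |t| < 2^(m+1)` with `m − p + 1 = k ≥ emin` (`m k : ℕ`) ⟹ `ulp(t) = 2^k`.
[cite: BoldoEtAl2023, §2.1] -/
private theorem ulp_natG {p : ℕ} {emin : ℤ} {t : ℚ} {m k : ℕ} (hk : (m : ℤ) - p + 1 = k)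
    (hm : emin ≤ (k : ℤ)) (h1 : (2 : ℚ) ^ m ≤ |t|) (h2 : |t| < (2 : ℚ) ^ (m + 1)) :
    ulp p emin t = (2 : ℚ) ^ k := by
  have hpos : 0 < |t| := lt_of_lt_of_le (by positivity) h1
  have hlo : (m : ℤ) ≤ Int.log 2 |t| :=
    (Int.zpow_le_iff_le_log (b := 2) (by norm_num) hpos).mp (by rw [zpow_natCast]; exact h1)
  have hhi : Int.log 2 |t| < (m : ℤ) + 1 :=
    (Int.lt_zpow_iff_log_lt (b := 2) (by norm_num) hpos).mp
      (by rw [show ((m : ℤ) + 1) = ((m + 1 : ℕ) : ℤ) by push_cast; ring, zpow_natCast]; exact h2)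
  have hlog : Int.log 2 |t| = m := le_antisymm (by omega) hlo
  rw [ulp_of_ne_zero (abs_pos.mp hpos), hlog, max_eq_right (by rw [hk]; exact hm), hk, zpow_natCast]

/-- `t = (N + r)·ulp(t)` with `0 ≤ r < 1` gives `⌊t/ulp(t)⌋ = N`. [cite: BoldoEtAl2023, §2.2] -/
private theorem rne_floorG {p : ℕ} {emin : ℤ} {t U r : ℚ} {N : ℤ} (hU : ulp p emin t = U)
    (hUpos : 0 < U) (ht : t = ((N : ℚ) + r) * U) (hr0 : 0 ≤ r) (hr1 : r < 1) :
    ⌊t / ulp p emin t⌋ = N := by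
  rw [hU, Int.floor_eq_iff, ht, mul_div_assoc, div_self hUpos.ne', mul_one]
  constructor <;> linarith

/-- ROUND-DOWN certificate at precision `q + 3`: binade `[2^m, 2^(m+1))`, `ulp = 2^k = U`
(`m − p + 1 = k ≥ 0 ≥ em`), `t = (N + r)·U` with `0 ≤ r < ½` ⟹ `RN_e(t) = N·U`. [cite: BoldoEtAl2023, §2.2] -/
private theorem rne_down_certG {t U r : ℚ} {N : ℤ} {m k : ℕ} (he : em ≤ 0)
    (hk : (m : ℤ) - (q + 3 : ℕ) + 1 = k) (h1 : (2 : ℚ) ^ m ≤ |t|) (h2 : |t| < (2 : ℚ) ^ (m + 1))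
    (hU : (2 : ℚ) ^ k = U) (ht : t = ((N : ℚ) + r) * U) (hr0 : 0 ≤ r) (hr : r < 1 / 2) :
    roundTiesEven (q + 3) em t = (N : ℚ) * U := by
  have hUpos : 0 < U := by rw [← hU]; positivity
  have hu : ulp (q + 3) em t = U := (ulp_natG hk (le_trans he (Int.natCast_nonneg _)) h1 h2).trans hU
  have hfl := rne_floorG hu hUpos ht hr0 (by linarith)
  have e1 : t - (N : ℚ) * U = r * U := by rw [ht]; ring
  have e2 : ((N : ℚ) + 1) * U - t = (1 - r) * U := by rw [ht]; ring
  have hlt : r * U < (1 - r) * U := mul_lt_mul_of_pos_right (by linarith) hUpos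
  unfold roundTiesEven
  rw [hfl, hu, e1, e2, if_pos hlt]

/-- ROUND-UP certificate at precision `q + 3`: as above with `½ < r < 1` ⟹ `RN_e(t) = (N+1)·U`.
[cite: BoldoEtAl2023, §2.2] -/
private theorem rne_up_certG {t U r : ℚ} {N : ℤ} {m k : ℕ} (he : em ≤ 0)
    (hk : (m : ℤ) - (q + 3 : ℕ) + 1 = k) (h1 : (2 : ℚ) ^ m ≤ |t|) (h2 : |t| < (2 : ℚ) ^ (m + 1))
    (hU : (2 : ℚ) ^ k = U) (ht : t = ((N : ℚ) + r) * U) (hr1 : r < 1) (hr : 1 / 2 < r) :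
    roundTiesEven (q + 3) em t = ((N : ℚ) + 1) * U := by
  have hUpos : 0 < U := by rw [← hU]; positivity
  have hu : ulp (q + 3) em t = U := (ulp_natG hk (le_trans he (Int.natCast_nonneg _)) h1 h2).trans hU
  have hfl := rne_floorG hu hUpos ht (by linarith) hr1
  have e1 : t - (N : ℚ) * U = r * U := by rw [ht]; ring
  have e2 : ((N : ℚ) + 1) * U - t = (1 - r) * U := by rw [ht]; ring
  have hgt : (1 - r) * U < r * U := mul_lt_mul_of_pos_right (by linarith) hUpos
  unfold roundTiesEven
  rw [hfl, hu, e1, e2, if_neg (not_lt.mpr hgt.le), if_pos hgt]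

/-- TIE certificate at precision `q + 3`: `t = (N + ½)·U` with `N` even ⟹ `RN_e(t) = N·U`.
[cite: BoldoEtAl2023, §2.2] -/
private theorem rne_tie_certG {t U : ℚ} {N : ℤ} {m k : ℕ} (he : em ≤ 0)
    (hk : (m : ℤ) - (q + 3 : ℕ) + 1 = k) (h1 : (2 : ℚ) ^ m ≤ |t|) (h2 : |t| < (2 : ℚ) ^ (m + 1))
    (hU : (2 : ℚ) ^ k = U) (ht : t = ((N : ℚ) + 1 / 2) * U) (hN : Even N) :
    roundTiesEven (q + 3) em t = (N : ℚ) * U := by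
  have hUpos : 0 < U := by rw [← hU]; positivity
  have hu : ulp (q + 3) em t = U := (ulp_natG hk (le_trans he (Int.natCast_nonneg _)) h1 h2).trans hU
  have hfl := rne_floorG hu hUpos ht (by norm_num) (by norm_num)
  have e1 : t - (N : ℚ) * U = 1 / 2 * U := by rw [ht]; ring
  have e2 : ((N : ℚ) + 1) * U - t = 1 / 2 * U := by rw [ht]; ring
  unfold roundTiesEven
  rw [hfl, hu, e1, e2, if_neg (lt_irrefl _), if_neg (lt_irrefl _), if_pos hN]

/-- The monotone chain `1 ≤ Y ≤ Y² ≤ ⋯ ≤ Y⁶` for `Y = 2^q` (feeds `linarith`). -/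
theorem yfactsG (q : ℕ) : (1 : ℚ) ≤ 2 ^ q ∧ (2 : ℚ) ^ q ≤ (2 ^ q) ^ 2 ∧
    ((2 : ℚ) ^ q) ^ 2 ≤ (2 ^ q) ^ 3 ∧ ((2 : ℚ) ^ q) ^ 3 ≤ (2 ^ q) ^ 4 ∧
    ((2 : ℚ) ^ q) ^ 4 ≤ (2 ^ q) ^ 5 ∧ ((2 : ℚ) ^ q) ^ 5 ≤ (2 ^ q) ^ 6 := by
  have h : (1 : ℚ) ≤ 2 ^ q := one_le_pow₀ (by norm_num)
  have h0 : (0 : ℚ) ≤ 2 ^ q := by positivity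
  refine ⟨h, ?_, ?_, ?_, ?_, ?_⟩ <;>
    nlinarith [pow_nonneg h0 2, pow_nonneg h0 3, pow_nonneg h0 4, pow_nonneg h0 5]


/-! ### The thirteen roundings (`p = q + 3`, `h = 4·2^q`, `em ≤ 0`) -/


/-- the window's top absorbs the old kink middle, `(3h/2+1)·2^(5p) + (−(h−1))·2^(4p)`
(`ulp = 32768 * (2 ^ q) ^ 5`; above the midpoint). [cite: BoldoEtAl2023, §2.2] -/
theorem rneG_k2_k1 (he : em ≤ 0) :
    roundTiesEven (q + 3) em ((6 * 2 ^ q + 1) * (32768 * (2 ^ q) ^ 5) + -(4 * 2 ^ q - 1) * (4096 * (2 ^ q) ^ 4)) =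
      (6 * 2 ^ q + 1) * (32768 * (2 ^ q) ^ 5) := by
  obtain ⟨hY, hY2, hY3, hY4, hY5, hY6⟩ := yfactsG q
  rw [show ((6 * 2 ^ q + 1) * (32768 * (2 ^ q) ^ 5) + -(4 * 2 ^ q - 1) * (4096 * (2 ^ q) ^ 4) : ℚ) =
      196608 * (2 ^ q) ^ 6 + 16384 * (2 ^ q) ^ 5 + 4096 * (2 ^ q) ^ 4 by ring]
  have hsg : (0 : ℚ) < 196608 * (2 ^ q) ^ 6 + 16384 * (2 ^ q) ^ 5 + 4096 * (2 ^ q) ^ 4 := by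
    linarith
  refine (rne_up_certG he (m := 6 * q + 17) (k := 5 * q + 15) (N := 6 * 2 ^ q)
    (r := 1 / 2 + 1 / (8 * 2 ^ q)) (U := 32768 * (2 ^ q) ^ 5) (by push_cast; ring)
    (by rw [abs_of_pos hsg, pow_add, pow_mul']; linarith)
    (by rw [abs_of_pos hsg, pow_add, pow_add, pow_mul']; linarith)
    (by rw [pow_add, pow_mul']; ring) (by push_cast; field_simp; ring) ?_ ?_).trans ?_
  · have : (1 : ℚ) / (8 * 2 ^ q) ≤ 1 / 8 := by
      rw [div_le_iff₀ (by positivity)]; nlinarith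
    linarith
  · have : (0 : ℚ) < 1 / (8 * 2 ^ q) := by positivity
    linarith
  · push_cast; ring

/-- the debris is born: `−(h−1)·2^(4p) + (−(h−1))·2^(3p) ↦ −(2h−1)·2^(4p−1)`, remainder `2^(3p)`
(`ulp = 2048 * (2 ^ q) ^ 4`; below the midpoint). [cite: BoldoEtAl2023, §2.2] -/
theorem rneG_k1_k0 (he : em ≤ 0) :
    roundTiesEven (q + 3) em (-(4 * 2 ^ q - 1) * (4096 * (2 ^ q) ^ 4) + -(4 * 2 ^ q - 1) * (512 * (2 ^ q) ^ 3)) =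
      -(8 * 2 ^ q - 1) * (2048 * (2 ^ q) ^ 4) := by
  obtain ⟨hY, hY2, hY3, hY4, hY5, hY6⟩ := yfactsG q
  rw [show (-(4 * 2 ^ q - 1) * (4096 * (2 ^ q) ^ 4) + -(4 * 2 ^ q - 1) * (512 * (2 ^ q) ^ 3) : ℚ) =
      -(16384 * (2 ^ q) ^ 5) + 2048 * (2 ^ q) ^ 4 + 512 * (2 ^ q) ^ 3 by ring]
  have hsg : -(16384 * (2 ^ q) ^ 5) + 2048 * (2 ^ q) ^ 4 + 512 * (2 ^ q) ^ 3 < (0 : ℚ) := by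
    linarith
  refine (rne_down_certG he (m := 5 * q + 13) (k := 4 * q + 11) (N := -(8 * 2 ^ q) + 1)
    (r := 1 / (4 * 2 ^ q)) (U := 2048 * (2 ^ q) ^ 4) (by push_cast; ring)
    (by rw [abs_of_neg hsg, pow_add, pow_mul']; linarith)
    (by rw [abs_of_neg hsg, pow_add, pow_add, pow_mul']; linarith)
    (by rw [pow_add, pow_mul']; ring) (by push_cast; field_simp; ring) (by positivity) ?_).trans ?_
  · rw [div_lt_iff₀ (by positivity)]; linarith
  · push_cast; ring

/-- THE TIE: `2^(3p) + (−(h−1))·2^(2p−1) = (3h+1)·2^(2p−1)`, the midpoint of `3h·2^(2p−1)` (even) and `(3h+2)·2^(2p−1)`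
(`ulp = 64 * (2 ^ q) ^ 2`; a tie, to even). [cite: BoldoEtAl2023, §2.2] -/
theorem rneG_c3_b (he : em ≤ 0) :
    roundTiesEven (q + 3) em (512 * (2 ^ q) ^ 3 + -(4 * 2 ^ q - 1) * (32 * (2 ^ q) ^ 2)) =
      384 * (2 ^ q) ^ 3 := by
  obtain ⟨hY, hY2, hY3, hY4, hY5, hY6⟩ := yfactsG q
  rw [show (512 * (2 ^ q) ^ 3 + -(4 * 2 ^ q - 1) * (32 * (2 ^ q) ^ 2) : ℚ) =
      384 * (2 ^ q) ^ 3 + 32 * (2 ^ q) ^ 2 by ring]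
  have hsg : (0 : ℚ) < 384 * (2 ^ q) ^ 3 + 32 * (2 ^ q) ^ 2 := by
    linarith
  refine (rne_tie_certG he (m := 3 * q + 8) (k := 2 * q + 6) (N := 6 * 2 ^ q)
    (U := 64 * (2 ^ q) ^ 2) (by push_cast; ring)
    (by rw [abs_of_pos hsg, pow_add, pow_mul']; linarith)
    (by rw [abs_of_pos hsg, pow_add, pow_add, pow_mul']; linarith)
    (by rw [pow_add, pow_mul']; ring) (by push_cast; ring) ⟨3 * 2 ^ q, by ring⟩).trans ?_
  push_cast; ring

/-- `2^(2p−1) + (h+1) ↦ (h+1)·2^p`, remainder `−(h−1)` = the bottom carry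
(`ulp = 8 * 2 ^ q`; above the midpoint). [cite: BoldoEtAl2023, §2.2] -/
theorem rneG_c2_a (he : em ≤ 0) :
    roundTiesEven (q + 3) em (32 * (2 ^ q) ^ 2 + (4 * 2 ^ q + 1)) =
      (4 * 2 ^ q + 1) * (8 * 2 ^ q) := by
  obtain ⟨hY, hY2, hY3, hY4, hY5, hY6⟩ := yfactsG q
  rw [show (32 * (2 ^ q) ^ 2 + (4 * 2 ^ q + 1) : ℚ) =
      32 * (2 ^ q) ^ 2 + 4 * 2 ^ q + 1 by ring]
  have hsg : (0 : ℚ) < 32 * (2 ^ q) ^ 2 + 4 * 2 ^ q + 1 := by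
    linarith
  refine (rne_up_certG he (m := 2 * q + 5) (k := q + 3) (N := 4 * 2 ^ q)
    (r := 1 / 2 + 1 / (8 * 2 ^ q)) (U := 8 * 2 ^ q) (by push_cast; ring)
    (by rw [abs_of_pos hsg, pow_add, pow_mul']; linarith)
    (by rw [abs_of_pos hsg, pow_add, pow_add, pow_mul']; linarith)
    (by rw [pow_add]; ring) (by push_cast; field_simp; ring) ?_ ?_).trans ?_
  · have : (1 : ℚ) / (8 * 2 ^ q) ≤ 1 / 8 := by
      rw [div_le_iff₀ (by positivity)]; nlinarith
    linarith
  · have : (0 : ℚ) < 1 / (8 * 2 ^ q) := by positivity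
    linarith
  · push_cast; ring

/-- the new kink top: `3·2^(3p−2) + (h+1)·2^p ↦ (3h/2+1)·2^(2p)`, remainder `−(h−1)·2^p`
(`ulp = 64 * (2 ^ q) ^ 2`; above the midpoint). [cite: BoldoEtAl2023, §2.2] -/
theorem rneG_g3_g4 (he : em ≤ 0) :
    roundTiesEven (q + 3) em (384 * (2 ^ q) ^ 3 + (4 * 2 ^ q + 1) * (8 * 2 ^ q)) =
      (6 * 2 ^ q + 1) * (64 * (2 ^ q) ^ 2) := by
  obtain ⟨hY, hY2, hY3, hY4, hY5, hY6⟩ := yfactsG q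
  rw [show (384 * (2 ^ q) ^ 3 + (4 * 2 ^ q + 1) * (8 * 2 ^ q) : ℚ) =
      384 * (2 ^ q) ^ 3 + 32 * (2 ^ q) ^ 2 + 8 * 2 ^ q by ring]
  have hsg : (0 : ℚ) < 384 * (2 ^ q) ^ 3 + 32 * (2 ^ q) ^ 2 + 8 * 2 ^ q := by
    linarith
  refine (rne_up_certG he (m := 3 * q + 8) (k := 2 * q + 6) (N := 6 * 2 ^ q)
    (r := 1 / 2 + 1 / (8 * 2 ^ q)) (U := 64 * (2 ^ q) ^ 2) (by push_cast; ring)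
    (by rw [abs_of_pos hsg, pow_add, pow_mul']; linarith)
    (by rw [abs_of_pos hsg, pow_add, pow_add, pow_mul']; linarith)
    (by rw [pow_add, pow_mul']; ring) (by push_cast; field_simp; ring) ?_ ?_).trans ?_
  · have : (1 : ℚ) / (8 * 2 ^ q) ≤ 1 / 8 := by
      rw [div_le_iff₀ (by positivity)]; nlinarith
    linarith
  · have : (0 : ℚ) < 1 / (8 * 2 ^ q) := by positivity
    linarith
  · push_cast; ring

/-- the debris does not see the new kink top: `−(2h−1)·2^(4p−1) + (3h/2+1)·2^(2p) ↦ −(2h−1)·2^(4p−1)`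
(`ulp = 2048 * (2 ^ q) ^ 4`; below the midpoint). [cite: BoldoEtAl2023, §2.2] -/
theorem rneG_d_m2 (he : em ≤ 0) :
    roundTiesEven (q + 3) em (-(8 * 2 ^ q - 1) * (2048 * (2 ^ q) ^ 4) + (6 * 2 ^ q + 1) * (64 * (2 ^ q) ^ 2)) =
      -(8 * 2 ^ q - 1) * (2048 * (2 ^ q) ^ 4) := by
  obtain ⟨hY, hY2, hY3, hY4, hY5, hY6⟩ := yfactsG q
  rw [show (-(8 * 2 ^ q - 1) * (2048 * (2 ^ q) ^ 4) + (6 * 2 ^ q + 1) * (64 * (2 ^ q) ^ 2) : ℚ) =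
      -(16384 * (2 ^ q) ^ 5) + 2048 * (2 ^ q) ^ 4 + 384 * (2 ^ q) ^ 3 + 64 * (2 ^ q) ^ 2 by ring]
  have hsg : -(16384 * (2 ^ q) ^ 5) + 2048 * (2 ^ q) ^ 4 + 384 * (2 ^ q) ^ 3 + 64 * (2 ^ q) ^ 2 < (0 : ℚ) := by
    linarith
  refine (rne_down_certG he (m := 5 * q + 13) (k := 4 * q + 11) (N := -(8 * 2 ^ q) + 1)
    (r := 3 / (16 * 2 ^ q) + 1 / (32 * (2 ^ q) ^ 2)) (U := 2048 * (2 ^ q) ^ 4) (by push_cast; ring)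
    (by rw [abs_of_neg hsg, pow_add, pow_mul']; linarith)
    (by rw [abs_of_neg hsg, pow_add, pow_add, pow_mul']; linarith)
    (by rw [pow_add, pow_mul']; ring) (by push_cast; field_simp; ring) (by positivity) ?_).trans ?_
  · have : (3 : ℚ) / (16 * 2 ^ q) ≤ 3 / 16 := by
      rw [div_le_iff₀ (by positivity)]; nlinarith
    have h' : (1 : ℚ) / (32 * (2 ^ q) ^ 2) ≤ 1 / 32 := by
      rw [div_le_iff₀ (by positivity)]; nlinarith
    linarith
  · push_cast; ring

/-- the top does not see the debris: `(3h/2+1)·2^(5p) + (−(2h−1))·2^(4p−1) ↦ (3h/2+1)·2^(5p)`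
(`ulp = 32768 * (2 ^ q) ^ 5`; above the midpoint). [cite: BoldoEtAl2023, §2.2] -/
theorem rneG_k2_d (he : em ≤ 0) :
    roundTiesEven (q + 3) em ((6 * 2 ^ q + 1) * (32768 * (2 ^ q) ^ 5) + -(8 * 2 ^ q - 1) * (2048 * (2 ^ q) ^ 4)) =
      (6 * 2 ^ q + 1) * (32768 * (2 ^ q) ^ 5) := by
  obtain ⟨hY, hY2, hY3, hY4, hY5, hY6⟩ := yfactsG q
  rw [show ((6 * 2 ^ q + 1) * (32768 * (2 ^ q) ^ 5) + -(8 * 2 ^ q - 1) * (2048 * (2 ^ q) ^ 4) : ℚ) =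
      196608 * (2 ^ q) ^ 6 + 16384 * (2 ^ q) ^ 5 + 2048 * (2 ^ q) ^ 4 by ring]
  have hsg : (0 : ℚ) < 196608 * (2 ^ q) ^ 6 + 16384 * (2 ^ q) ^ 5 + 2048 * (2 ^ q) ^ 4 := by
    linarith
  refine (rne_up_certG he (m := 6 * q + 17) (k := 5 * q + 15) (N := 6 * 2 ^ q)
    (r := 1 / 2 + 1 / (16 * 2 ^ q)) (U := 32768 * (2 ^ q) ^ 5) (by push_cast; ring)
    (by rw [abs_of_pos hsg, pow_add, pow_mul']; linarith)
    (by rw [abs_of_pos hsg, pow_add, pow_add, pow_mul']; linarith)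
    (by rw [pow_add, pow_mul']; ring) (by push_cast; field_simp; ring) ?_ ?_).trans ?_
  · have : (1 : ℚ) / (16 * 2 ^ q) ≤ 1 / 16 := by
      rw [div_le_iff₀ (by positivity)]; nlinarith
    linarith
  · have : (0 : ℚ) < 1 / (16 * 2 ^ q) := by positivity
    linarith
  · push_cast; ring

/-- the kink's last step: `−(h−1)·2^p + (−(h−1)) ↦ −(2h−1)·2^(p−1)`, remainder `1`
(`ulp = 4 * 2 ^ q`; below the midpoint). [cite: BoldoEtAl2023, §2.2] -/
theorem rneG_m1_m0 (he : em ≤ 0) :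
    roundTiesEven (q + 3) em (-(4 * 2 ^ q - 1) * (8 * 2 ^ q) + -(4 * 2 ^ q - 1)) =
      -(8 * 2 ^ q - 1) * (4 * 2 ^ q) := by
  obtain ⟨hY, hY2, hY3, hY4, hY5, hY6⟩ := yfactsG q
  rw [show (-(4 * 2 ^ q - 1) * (8 * 2 ^ q) + -(4 * 2 ^ q - 1) : ℚ) =
      -(32 * (2 ^ q) ^ 2) + 4 * 2 ^ q + 1 by ring]
  have hsg : -(32 * (2 ^ q) ^ 2) + 4 * 2 ^ q + 1 < (0 : ℚ) := by
    linarith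
  refine (rne_down_certG he (m := 2 * q + 4) (k := q + 2) (N := -(8 * 2 ^ q) + 1)
    (r := 1 / (4 * 2 ^ q)) (U := 4 * 2 ^ q) (by push_cast; ring)
    (by rw [abs_of_neg hsg, pow_add, pow_mul']; linarith)
    (by rw [abs_of_neg hsg, pow_add, pow_add, pow_mul']; linarith)
    (by rw [pow_add]; ring) (by push_cast; field_simp; ring) (by positivity) ?_).trans ?_
  · rw [div_lt_iff₀ (by positivity)]; linarith
  · push_cast; ring

/-- the final kink's top is inert: `(3h/2+1)·2^(2p) + (−(2h−1))·2^(p−1) ↦ (3h/2+1)·2^(2p)`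
(`ulp = 64 * (2 ^ q) ^ 2`; above the midpoint). [cite: BoldoEtAl2023, §2.2] -/
theorem rneG_m2_f1 (he : em ≤ 0) :
    roundTiesEven (q + 3) em ((6 * 2 ^ q + 1) * (64 * (2 ^ q) ^ 2) + -(8 * 2 ^ q - 1) * (4 * 2 ^ q)) =
      (6 * 2 ^ q + 1) * (64 * (2 ^ q) ^ 2) := by
  obtain ⟨hY, hY2, hY3, hY4, hY5, hY6⟩ := yfactsG q
  rw [show ((6 * 2 ^ q + 1) * (64 * (2 ^ q) ^ 2) + -(8 * 2 ^ q - 1) * (4 * 2 ^ q) : ℚ) =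
      384 * (2 ^ q) ^ 3 + 32 * (2 ^ q) ^ 2 + 4 * 2 ^ q by ring]
  have hsg : (0 : ℚ) < 384 * (2 ^ q) ^ 3 + 32 * (2 ^ q) ^ 2 + 4 * 2 ^ q := by
    linarith
  refine (rne_up_certG he (m := 3 * q + 8) (k := 2 * q + 6) (N := 6 * 2 ^ q)
    (r := 1 / 2 + 1 / (16 * 2 ^ q)) (U := 64 * (2 ^ q) ^ 2) (by push_cast; ring)
    (by rw [abs_of_pos hsg, pow_add, pow_mul']; linarith)
    (by rw [abs_of_pos hsg, pow_add, pow_add, pow_mul']; linarith)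
    (by rw [pow_add, pow_mul']; ring) (by push_cast; field_simp; ring) ?_ ?_).trans ?_
  · have : (1 : ℚ) / (16 * 2 ^ q) ≤ 1 / 16 := by
      rw [div_le_iff₀ (by positivity)]; nlinarith
    linarith
  · have : (0 : ℚ) < 1 / (16 * 2 ^ q) := by positivity
    linarith
  · push_cast; ring

/-- INERT pair block: `−(h−1)·2^(2p−1) + (h+1) ↦ −(h−1)·2^(2p−1)`
(`ulp = 16 * (2 ^ q) ^ 2`; below the midpoint). [cite: BoldoEtAl2023, §2.2] -/
theorem rneG_b_a (he : em ≤ 0) :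
    roundTiesEven (q + 3) em (-(4 * 2 ^ q - 1) * (32 * (2 ^ q) ^ 2) + (4 * 2 ^ q + 1)) =
      -(4 * 2 ^ q - 1) * (32 * (2 ^ q) ^ 2) := by
  obtain ⟨hY, hY2, hY3, hY4, hY5, hY6⟩ := yfactsG q
  rw [show (-(4 * 2 ^ q - 1) * (32 * (2 ^ q) ^ 2) + (4 * 2 ^ q + 1) : ℚ) =
      -(128 * (2 ^ q) ^ 3) + 32 * (2 ^ q) ^ 2 + 4 * 2 ^ q + 1 by ring]
  have hsg : -(128 * (2 ^ q) ^ 3) + 32 * (2 ^ q) ^ 2 + 4 * 2 ^ q + 1 < (0 : ℚ) := by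
    linarith
  refine (rne_down_certG he (m := 3 * q + 6) (k := 2 * q + 4) (N := -(8 * 2 ^ q) + 2)
    (r := 1 / (4 * 2 ^ q) + 1 / (16 * (2 ^ q) ^ 2)) (U := 16 * (2 ^ q) ^ 2) (by push_cast; ring)
    (by rw [abs_of_neg hsg, pow_add, pow_mul']; linarith)
    (by rw [abs_of_neg hsg, pow_add, pow_add, pow_mul']; linarith)
    (by rw [pow_add, pow_mul']; ring) (by push_cast; field_simp; ring) (by positivity) ?_).trans ?_
  · have : (1 : ℚ) / (4 * 2 ^ q) ≤ 1 / 4 := by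
      rw [div_le_iff₀ (by positivity)]; nlinarith
    have h' : (1 : ℚ) / (16 * (2 ^ q) ^ 2) ≤ 1 / 16 := by
      rw [div_le_iff₀ (by positivity)]; nlinarith
    linarith
  · push_cast; ring

/-- INERT block boundary: `(h+1)·2^(3p) + (−(h−1))·2^(2p−1) ↦ (h+1)·2^(3p)`
(`ulp = 512 * (2 ^ q) ^ 3`; above the midpoint). [cite: BoldoEtAl2023, §2.2] -/
theorem rneG_a3_b (he : em ≤ 0) :
    roundTiesEven (q + 3) em ((4 * 2 ^ q + 1) * (512 * (2 ^ q) ^ 3) + -(4 * 2 ^ q - 1) * (32 * (2 ^ q) ^ 2)) =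
      (4 * 2 ^ q + 1) * (512 * (2 ^ q) ^ 3) := by
  obtain ⟨hY, hY2, hY3, hY4, hY5, hY6⟩ := yfactsG q
  rw [show ((4 * 2 ^ q + 1) * (512 * (2 ^ q) ^ 3) + -(4 * 2 ^ q - 1) * (32 * (2 ^ q) ^ 2) : ℚ) =
      2048 * (2 ^ q) ^ 4 + 384 * (2 ^ q) ^ 3 + 32 * (2 ^ q) ^ 2 by ring]
  have hsg : (0 : ℚ) < 2048 * (2 ^ q) ^ 4 + 384 * (2 ^ q) ^ 3 + 32 * (2 ^ q) ^ 2 := by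
    linarith
  refine (rne_up_certG he (m := 4 * q + 11) (k := 3 * q + 9) (N := 4 * 2 ^ q)
    (r := 3 / 4 + 1 / (16 * 2 ^ q)) (U := 512 * (2 ^ q) ^ 3) (by push_cast; ring)
    (by rw [abs_of_pos hsg, pow_add, pow_mul']; linarith)
    (by rw [abs_of_pos hsg, pow_add, pow_add, pow_mul']; linarith)
    (by rw [pow_add, pow_mul']; ring) (by push_cast; field_simp; ring) ?_ ?_).trans ?_
  · have : (1 : ℚ) / (16 * 2 ^ q) ≤ 1 / 16 := by
      rw [div_le_iff₀ (by positivity)]; nlinarith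
    linarith
  · have : (0 : ℚ) < 1 / (16 * 2 ^ q) := by positivity
    linarith
  · push_cast; ring

/-- INERT kink bottom over the pair below: `−(h−1)·2^(3p) + (−(h−1))·2^(2p−1) ↦ −(h−1)·2^(3p)`
(`ulp = 256 * (2 ^ q) ^ 3`; above the midpoint). [cite: BoldoEtAl2023, §2.2] -/
theorem rneG_k0_b (he : em ≤ 0) :
    roundTiesEven (q + 3) em (-(4 * 2 ^ q - 1) * (512 * (2 ^ q) ^ 3) + -(4 * 2 ^ q - 1) * (32 * (2 ^ q) ^ 2)) =
      -(4 * 2 ^ q - 1) * (512 * (2 ^ q) ^ 3) := by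
  obtain ⟨hY, hY2, hY3, hY4, hY5, hY6⟩ := yfactsG q
  rw [show (-(4 * 2 ^ q - 1) * (512 * (2 ^ q) ^ 3) + -(4 * 2 ^ q - 1) * (32 * (2 ^ q) ^ 2) : ℚ) =
      -(2048 * (2 ^ q) ^ 4) + 384 * (2 ^ q) ^ 3 + 32 * (2 ^ q) ^ 2 by ring]
  have hsg : -(2048 * (2 ^ q) ^ 4) + 384 * (2 ^ q) ^ 3 + 32 * (2 ^ q) ^ 2 < (0 : ℚ) := by
    linarith
  refine (rne_up_certG he (m := 4 * q + 10) (k := 3 * q + 8) (N := -(8 * 2 ^ q) + 1)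
    (r := 1 / 2 + 1 / (8 * 2 ^ q)) (U := 256 * (2 ^ q) ^ 3) (by push_cast; ring)
    (by rw [abs_of_neg hsg, pow_add, pow_mul']; linarith)
    (by rw [abs_of_neg hsg, pow_add, pow_add, pow_mul']; linarith)
    (by rw [pow_add, pow_mul']; ring) (by push_cast; field_simp; ring) ?_ ?_).trans ?_
  · have : (1 : ℚ) / (8 * 2 ^ q) ≤ 1 / 8 := by
      rw [div_le_iff₀ (by positivity)]; nlinarith
    linarith
  · have : (0 : ℚ) < 1 / (8 * 2 ^ q) := by positivity
    linarith
  · push_cast; ring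

/-- INERT summit over the kink top: `−(h+1)·2^(4p) + (3h/2+1)·2^(2p) ↦ −(h+1)·2^(4p)`
(`ulp = 4096 * (2 ^ q) ^ 4`; below the midpoint). [cite: BoldoEtAl2023, §2.2] -/
theorem rneG_S_m2 (he : em ≤ 0) :
    roundTiesEven (q + 3) em (-(4 * 2 ^ q + 1) * (4096 * (2 ^ q) ^ 4) + (6 * 2 ^ q + 1) * (64 * (2 ^ q) ^ 2)) =
      -(4 * 2 ^ q + 1) * (4096 * (2 ^ q) ^ 4) := by
  obtain ⟨hY, hY2, hY3, hY4, hY5, hY6⟩ := yfactsG q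
  rw [show (-(4 * 2 ^ q + 1) * (4096 * (2 ^ q) ^ 4) + (6 * 2 ^ q + 1) * (64 * (2 ^ q) ^ 2) : ℚ) =
      -(16384 * (2 ^ q) ^ 5) - 4096 * (2 ^ q) ^ 4 + 384 * (2 ^ q) ^ 3 + 64 * (2 ^ q) ^ 2 by ring]
  have hsg : -(16384 * (2 ^ q) ^ 5) - 4096 * (2 ^ q) ^ 4 + 384 * (2 ^ q) ^ 3 + 64 * (2 ^ q) ^ 2 < (0 : ℚ) := by
    linarith
  refine (rne_down_certG he (m := 5 * q + 14) (k := 4 * q + 12) (N := -(4 * 2 ^ q) - 1)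
    (r := 3 / (32 * 2 ^ q) + 1 / (64 * (2 ^ q) ^ 2)) (U := 4096 * (2 ^ q) ^ 4) (by push_cast; ring)
    (by rw [abs_of_neg hsg, pow_add, pow_mul']; linarith)
    (by rw [abs_of_neg hsg, pow_add, pow_add, pow_mul']; linarith)
    (by rw [pow_add, pow_mul']; ring) (by push_cast; field_simp; ring) (by positivity) ?_).trans ?_
  · have : (3 : ℚ) / (32 * 2 ^ q) ≤ 3 / 32 := by
      rw [div_le_iff₀ (by positivity)]; nlinarith
    have h' : (1 : ℚ) / (64 * (2 ^ q) ^ 2) ≤ 1 / 64 := by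
      rw [div_le_iff₀ (by positivity)]; nlinarith
    linarith
  · push_cast; ring

end Summit.Ventures.CertifiedArithmetic.Expansions
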